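import Summits.Ventures.CertifiedManyBodySolver.Observables.RungLeavesCoverageNdNiO2ResidualDensityBundlesCaps
import Summits.Ventures.CertifiedManyBodySolver.Rows.DopedTLCorrBoxWindow
import HarnessLib

/-!
# Ventures/CertifiedManyBodySolver — Observables/RungLeavesCoverageNdNiO2ResidualDensityBundlesBox.lean

HONEST FRAMING: one-sided certified CEILINGS on the uniform flux stiffness on the DOWNFOLDED d⁹-nickelate box of record `boxNdNiO2E_M21` (NdNiO₂ parent
film; router/BOXES/NdNiO2.md «1BH+3BE», SCREENING-GRADE) — wording class (xx1): CONTROL / CALIBRATION + labelled heuristic; a ceiling never speaks to the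
presence of superconductivity; never «certified true negative / positive»; not a `T_c` or phase-diagram statement; no summit statement is proved here.
CONDITIONAL closers only: every conclusion is conditional BY NAME on the rows and window tables it names; no number of record is asserted; no `sorry`;
no definition; zero compute.

Cells `pub/hubbard-obs` ∧ `pub/hubbard-downfold` (MO-S2 ∧ MO-S1, D-0154 (1)(C) COVERAGE material (iii) NdNiO₂), seat `hubbard-cov-ndnio2-unc-3`
(`prover-hubbard-cov-ndnio2-unc-3-g2-0`; DENSITY lane; write_cruxes stmt-Ventures-26751 `ResidualLowUSlab` / stmt-Ventures-26752 `ResidualHighUSlab` of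
route-Ventures-CovNdNiO2M21 — SUPPORT, no claim). Fourth part of `Observables/RungLeavesCoverageNdNiO2ResidualDensityBundles{,High,Caps}.lean` — FORMAT INSURANCE.
Parts 1–3 take the density-affine `t′`-bundle shape `TPrimeBundleOrbitLowerRowWN` (one anchor `477/500` + printed density slopes). A producer may instead deliver a
`boxdual/0` word over a genuine `(t′, n)` CELL at the station (vertex programs at both density edges; hubbard-box-eng-3's tree cells
`SquareTTPrimeCorrOrbitLowerBoxRow lo hi cap r S Λ X` / `…BoxRowW lo hi flo cap r S Λ X` of `Rows/DopedTLCorrBox{,Window}.lean`, box coordinates `θ = (U, t′, n)`).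
So this file states the closers over the weakest common currency — a CONSTANT orbit-lower value per (segment × R‴) rectangle — and the adapters into it:

* §10 `orbitLowerOn_rect_of_boxRow` / `orbitLowerOn_rect_of_boxRowW` — a box row on `{U_A} × [s₁, s₂] × [x₁, x₂] ⊇ {U_A} × [a, b] × [x₁', x₂']` + its cap (floor)
  FUNCTION discharged on the used sub-rectangle ⇒ the constant family `r ≤ |D₄|⁻¹ Σ_γ Re ω_γ(Γ_γ X)` at every `(s, U_A, x)` there (coordinate bookkeeping only;
  `SquareTTPrimeCorrOrbitLowerBoxRow.uncond`); `constFamily_of_bundleRowWN` — a WN bundle family read as a constant one (`F + min(sl₁,sl₂)(x − n₀) ≥ m` on R‴);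
* §11 `ndM21_residualLowUSlab_of_constFamilies` — six CONSTANT families (objectives `−X₀(−23/50, 5)`, `−X₀(−11/25, 5)` × rectangles `[−184/325, −11/20]`,
  `[−11/20, −23/50]`, `[−23/50, −11/25]` × R‴), six prices `−r ≤ c`, `c ≤ 4779578/10⁷` ⇒ the statement of `Theses.CovNdNiO2M21.ResidualLowUSlab`;
  `ndM21_residualHighUSlab_of_constFamilies` — four (station 5, `[−276/425, −11/20]`, `[−11/20, −176/325]`) ⇒ the statement of `ResidualHighUSlab`.

NOT said: that any box or bundle certificate exists for NdNiO₂; which format the producers choose; a number of record; anything toward smaller `U`.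

References: S. Boyd, L. Vandenberghe, *Convex Optimization* (2004) §5.9 [BoydVandenberghe2004]; T. Koma, H. Tasaki, J. Stat. Phys. 76 (1994) 745, §1
[KomaTasaki1994]; D. J. Scalapino, S. R. White, S.-C. Zhang, PRB 47 (1993) 7995, §II [ScalapinoWhiteZhang1993].
-/

noncomputable section

namespace Summit.Ventures.CertifiedManyBodySolver.Observables

open Set Filter Topology
open Summit.Ventures.CertifiedManyBodySolver.Downfold
open Summit.Ventures.CertifiedManyBodySolver.Certificates
open Literature.MathematicalPhysics.QuantumLattice Literature.MathematicalPhysics.QuantumLattice.ThermodynamicLimit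
open Literature.Probability.LatticeModels
open Matrix HubbardWave0
open scoped BigOperators ComplexOrder

/-! ## §10 Adapters: box rows and WN bundle rows read as CONSTANT families on a rectangle -/

section Adapters

variable {UA : ℝ}

/-- The point `![U_A, s, x]` of a sub-rectangle lies in the box `[![U_A, s₁, x₁], ![U_A, s₂, x₂]]`. [folklore] -/
theorem vec3_mem_Icc_of_mem {s₁ s₂ x₁ x₂ a b x₁' x₂' s x : ℝ} (ha : s₁ ≤ a) (hb : b ≤ s₂) (hx₁ : x₁ ≤ x₁') (hx₂ : x₂' ≤ x₂)
    (hs : s ∈ Set.Icc a b) (hx : x ∈ Set.Icc x₁' x₂') :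
    (![UA, s, x] : Fin 3 → ℝ) ∈ Set.Icc (![UA, s₁, x₁] : Fin 3 → ℝ) ![UA, s₂, x₂] :=
  ⟨fun i => by fin_cases i <;> simp [ha.trans hs.1, hx₁.trans hx.1],
    fun i => by fin_cases i <;> simp [hs.2.trans hb, hx.2.trans hx₂]⟩

/-- **BOX ROW (cap form) ⇒ CONSTANT FAMILY on a sub-rectangle.** A `boxdual/0` cell `SquareTTPrimeCorrOrbitLowerBoxRow ![U_A, s₁, x₁] ![U_A, s₂, x₂] cap r univ Λ₇ X` at the
station `U_A` with its cap FUNCTION discharged on `[a, b] × [x₁', x₂'] ⊆ [s₁, s₂] × [x₁, x₂]` gives `r ≤ |D₄|⁻¹ Σ_γ Re ω_γ(Γ_γ X)` on the torus-limit ground-state class at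
every `(s, U_A, x)` of the sub-rectangle. [cite: BoydVandenberghe2004, §5.9] [cite: KomaTasaki1994, §1] -/
theorem orbitLowerOn_rect_of_boxRow {s₁ s₂ x₁ x₂ a b x₁' x₂' : ℝ} {cap : (Fin 3 → ℝ) → ℝ} {r : ℚ}
    {X : FermionOp (Literature.Probability.LatticeModels.box 2 7)}
    (h : SquareTTPrimeCorrOrbitLowerBoxRow ![UA, s₁, x₁] ![UA, s₂, x₂] cap r Finset.univ (Literature.Probability.LatticeModels.box 2 7) X)
    (ha : s₁ ≤ a) (hb : b ≤ s₂) (hx₁ : x₁ ≤ x₁') (hx₂ : x₂' ≤ x₂)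
    (hcap : ∀ s ∈ Set.Icc a b, ∀ x ∈ Set.Icc x₁' x₂', energyDensityTT' 1 s UA x ≤ cap ![UA, s, x]) :
    ∀ x ∈ Set.Icc x₁' x₂', ∀ s ∈ Set.Icc a b,
      ∀ (ω : InfVolFermionState 2) (Ls : ℕ → ℕ) (ψ : ∀ L, Fock (Orb (FermionTorus 2 L))),
      Tendsto Ls atTop atTop →
      (∀ j, IsGroundStateInSector (hubbardTorusTT' (Ls j) 1 s UA) (rectN x (Ls j)) 0 (ψ (Ls j))) →
      (∀ j, star (ψ (Ls j)) ⬝ᵥ ψ (Ls j) = 1) → ω.IsTorusLimitOf ψ Ls →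
      ((r : ℚ) : ℝ) ≤ ((Finset.univ : Finset (DihedralGroup 4)).card : ℝ)⁻¹ *
        ∑ g ∈ (Finset.univ : Finset (DihedralGroup 4)),
          (ω.expect (d4ShiftSet g 0 (Literature.Probability.LatticeModels.box 2 7))
            (fermionEmbed (PolySite.d4Emb g 0 (Literature.Probability.LatticeModels.box 2 7)) X)).re := by
  intro x hx s hs ω Ls ψ hLs hψ h1 hω
  have hθ := vec3_mem_Icc_of_mem (UA := UA) ha hb hx₁ hx₂ hs hx
  exact h _ hθ ω Ls ψ hLs hψ h1 hω (hcap s hs x hx)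

/-- **BOX ROW (window form) ⇒ CONSTANT FAMILY on a sub-rectangle**: the same for `SquareTTPrimeCorrOrbitLowerBoxRowW … flo cap r …` with BOTH window functions
discharged on the sub-rectangle (floor side: e.g. `bandBottomFloor_on_rect`). [cite: BoydVandenberghe2004, §5.9] [cite: KomaTasaki1994, §1] -/
theorem orbitLowerOn_rect_of_boxRowW {s₁ s₂ x₁ x₂ a b x₁' x₂' : ℝ} {flo cap : (Fin 3 → ℝ) → ℝ} {r : ℚ}
    {X : FermionOp (Literature.Probability.LatticeModels.box 2 7)}
    (h : SquareTTPrimeCorrOrbitLowerBoxRowW ![UA, s₁, x₁] ![UA, s₂, x₂] flo cap r Finset.univ (Literature.Probability.LatticeModels.box 2 7) X)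
    (ha : s₁ ≤ a) (hb : b ≤ s₂) (hx₁ : x₁ ≤ x₁') (hx₂ : x₂' ≤ x₂)
    (hflo : ∀ s ∈ Set.Icc a b, ∀ x ∈ Set.Icc x₁' x₂', flo ![UA, s, x] ≤ energyDensityTT' 1 s UA x)
    (hcap : ∀ s ∈ Set.Icc a b, ∀ x ∈ Set.Icc x₁' x₂', energyDensityTT' 1 s UA x ≤ cap ![UA, s, x]) :
    ∀ x ∈ Set.Icc x₁' x₂', ∀ s ∈ Set.Icc a b,
      ∀ (ω : InfVolFermionState 2) (Ls : ℕ → ℕ) (ψ : ∀ L, Fock (Orb (FermionTorus 2 L))),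
      Tendsto Ls atTop atTop →
      (∀ j, IsGroundStateInSector (hubbardTorusTT' (Ls j) 1 s UA) (rectN x (Ls j)) 0 (ψ (Ls j))) →
      (∀ j, star (ψ (Ls j)) ⬝ᵥ ψ (Ls j) = 1) → ω.IsTorusLimitOf ψ Ls →
      ((r : ℚ) : ℝ) ≤ ((Finset.univ : Finset (DihedralGroup 4)).card : ℝ)⁻¹ *
        ∑ g ∈ (Finset.univ : Finset (DihedralGroup 4)),
          (ω.expect (d4ShiftSet g 0 (Literature.Probability.LatticeModels.box 2 7))
            (fermionEmbed (PolySite.d4Emb g 0 (Literature.Probability.LatticeModels.box 2 7)) X)).re := by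
  intro x hx s hs ω Ls ψ hLs hψ h1 hω
  have hθ := vec3_mem_Icc_of_mem (UA := UA) ha hb hx₁ hx₂ hs hx
  exact h _ hθ ω Ls ψ hLs hψ h1 hω (hflo s hs x hx) (hcap s hs x hx)

/-- **WN BUNDLE FAMILY READ AS A CONSTANT ONE**: if `m ≤ F + sl_j·(x_e − n₀)` at both ends `x_e ∈ {x₁, x₂}` for both slopes, then `m ≤ wnBundleValue F sl₁ sl₂ n₀ x` on `[x₁, x₂]`
(each branch affine in `x`), so a family valued `wnBundleValue …` is also one valued `m`. [cite: BoydVandenberghe2004, §5.9] -/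
theorem le_wnBundleValue_on_Icc_of_ends {F sl₁ sl₂ n₀ m : ℚ} {x₁ x₂ : ℝ}
    (h₁₁ : ((m : ℚ) : ℝ) ≤ ((F : ℚ) : ℝ) + ((sl₁ : ℚ) : ℝ) * (x₁ - ((n₀ : ℚ) : ℝ)))
    (h₁₂ : ((m : ℚ) : ℝ) ≤ ((F : ℚ) : ℝ) + ((sl₁ : ℚ) : ℝ) * (x₂ - ((n₀ : ℚ) : ℝ)))
    (h₂₁ : ((m : ℚ) : ℝ) ≤ ((F : ℚ) : ℝ) + ((sl₂ : ℚ) : ℝ) * (x₁ - ((n₀ : ℚ) : ℝ)))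
    (h₂₂ : ((m : ℚ) : ℝ) ≤ ((F : ℚ) : ℝ) + ((sl₂ : ℚ) : ℝ) * (x₂ - ((n₀ : ℚ) : ℝ))) :
    ∀ x ∈ Set.Icc x₁ x₂, ((m : ℚ) : ℝ) ≤ wnBundleValue F sl₁ sl₂ n₀ x := by
  intro x hx
  unfold wnBundleValue
  have b₁ : ((m : ℚ) : ℝ) ≤ ((F : ℚ) : ℝ) + ((sl₁ : ℚ) : ℝ) * (x - ((n₀ : ℚ) : ℝ)) := by
    rcases le_total 0 ((sl₁ : ℚ) : ℝ) with hp | hn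
    · nlinarith [hx.1, mul_le_mul_of_nonneg_left hx.1 hp]
    · nlinarith [hx.2, mul_le_mul_of_nonpos_left hx.2 hn]
  have b₂ : ((m : ℚ) : ℝ) ≤ ((F : ℚ) : ℝ) + ((sl₂ : ℚ) : ℝ) * (x - ((n₀ : ℚ) : ℝ)) := by
    rcases le_total 0 ((sl₂ : ℚ) : ℝ) with hp | hn
    · nlinarith [hx.1, mul_le_mul_of_nonneg_left hx.1 hp]
    · nlinarith [hx.2, mul_le_mul_of_nonpos_left hx.2 hn]
  rcases le_total (((sl₁ : ℚ) : ℝ) * (x - ((n₀ : ℚ) : ℝ))) (((sl₂ : ℚ) : ℝ) * (x - ((n₀ : ℚ) : ℝ))) with hle | hle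
  · rw [min_eq_left hle]; exact b₁
  · rw [min_eq_right hle]; exact b₂

end Adapters

/-! ## §11 Station `U_A = 5`: the closers from CONSTANT families (one rational value per rectangle per objective) -/

section ConstFamilies

/-- Abbreviated hypothesis shape used below (documentation only — spelled out in each binder): «constant family `r` on `[a, b] × R‴` for the objective slot `σ`»
means `∀ x ∈ R‴, ∀ s ∈ [a, b]`, every torus-limit ground state at `(s, 5, x)` has `r ≤ |D₄|⁻¹ Σ_γ Re ω_γ(Γ_γ(−X₀(σ, 5)))`. **`ResidualLowUSlab` FROM SIX CONSTANT
FAMILIES** (`P = −23/50`, `Q = −11/25` × rectangles `[−184/325, −11/20]`, `[−11/20, −23/50]`, `[−23/50, −11/25]` × R‴), six prices `−r ≤ c`, `c ≤ 4779578/10⁷` ⇒ the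
statement of `Theses.CovNdNiO2M21.ResidualLowUSlab` (composition as in part 1: density split at `183/200`, unc-2's box theorem with `U_max = 13/2`, σ-chord). The families come
from box rows (§10), from WN bundles (`orbitLowerOn_subrect_of_bundleRowWN` + `le_wnBundleValue_on_Icc_of_ends`), or from any finer certificate format.
[cite: KomaTasaki1994, §1] [cite: ScalapinoWhiteZhang1993, §II] -/
theorem ndM21_residualLowUSlab_of_constFamilies {rPA rQA rPB rQB rPC rQC c : ℚ}
    (hPA : ∀ x ∈ Set.Icc (183 / 200 : ℝ) (477 / 500), ∀ s ∈ Set.Icc (-(184 / 325) : ℝ) (-11 / 20),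
      ∀ (ω : InfVolFermionState 2) (Ls : ℕ → ℕ) (ψ : ∀ L, Fock (Orb (FermionTorus 2 L))),
      Tendsto Ls atTop atTop →
      (∀ j, IsGroundStateInSector (hubbardTorusTT' (Ls j) 1 s 5) (rectN x (Ls j)) 0 (ψ (Ls j))) →
      (∀ j, star (ψ (Ls j)) ⬝ᵥ ψ (Ls j) = 1) → ω.IsTorusLimitOf ψ Ls →
      ((rPA : ℚ) : ℝ) ≤ ((Finset.univ : Finset (DihedralGroup 4)).card : ℝ)⁻¹ * ∑ g ∈ (Finset.univ : Finset (DihedralGroup 4)),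
        (ω.expect (d4ShiftSet g 0 (Literature.Probability.LatticeModels.box 2 7))
          (fermionEmbed (PolySite.d4Emb g 0 (Literature.Probability.LatticeModels.box 2 7)) (-oddMomentObsTT (-23 / 50) 5 0))).re)
    (hQA : ∀ x ∈ Set.Icc (183 / 200 : ℝ) (477 / 500), ∀ s ∈ Set.Icc (-(184 / 325) : ℝ) (-11 / 20),
      ∀ (ω : InfVolFermionState 2) (Ls : ℕ → ℕ) (ψ : ∀ L, Fock (Orb (FermionTorus 2 L))),
      Tendsto Ls atTop atTop →
      (∀ j, IsGroundStateInSector (hubbardTorusTT' (Ls j) 1 s 5) (rectN x (Ls j)) 0 (ψ (Ls j))) →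
      (∀ j, star (ψ (Ls j)) ⬝ᵥ ψ (Ls j) = 1) → ω.IsTorusLimitOf ψ Ls →
      ((rQA : ℚ) : ℝ) ≤ ((Finset.univ : Finset (DihedralGroup 4)).card : ℝ)⁻¹ * ∑ g ∈ (Finset.univ : Finset (DihedralGroup 4)),
        (ω.expect (d4ShiftSet g 0 (Literature.Probability.LatticeModels.box 2 7))
          (fermionEmbed (PolySite.d4Emb g 0 (Literature.Probability.LatticeModels.box 2 7)) (-oddMomentObsTT (-11 / 25) 5 0))).re)
    (hPB : ∀ x ∈ Set.Icc (183 / 200 : ℝ) (477 / 500), ∀ s ∈ Set.Icc (-11 / 20 : ℝ) (-23 / 50),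
      ∀ (ω : InfVolFermionState 2) (Ls : ℕ → ℕ) (ψ : ∀ L, Fock (Orb (FermionTorus 2 L))),
      Tendsto Ls atTop atTop →
      (∀ j, IsGroundStateInSector (hubbardTorusTT' (Ls j) 1 s 5) (rectN x (Ls j)) 0 (ψ (Ls j))) →
      (∀ j, star (ψ (Ls j)) ⬝ᵥ ψ (Ls j) = 1) → ω.IsTorusLimitOf ψ Ls →
      ((rPB : ℚ) : ℝ) ≤ ((Finset.univ : Finset (DihedralGroup 4)).card : ℝ)⁻¹ * ∑ g ∈ (Finset.univ : Finset (DihedralGroup 4)),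
        (ω.expect (d4ShiftSet g 0 (Literature.Probability.LatticeModels.box 2 7))
          (fermionEmbed (PolySite.d4Emb g 0 (Literature.Probability.LatticeModels.box 2 7)) (-oddMomentObsTT (-23 / 50) 5 0))).re)
    (hQB : ∀ x ∈ Set.Icc (183 / 200 : ℝ) (477 / 500), ∀ s ∈ Set.Icc (-11 / 20 : ℝ) (-23 / 50),
      ∀ (ω : InfVolFermionState 2) (Ls : ℕ → ℕ) (ψ : ∀ L, Fock (Orb (FermionTorus 2 L))),
      Tendsto Ls atTop atTop →
      (∀ j, IsGroundStateInSector (hubbardTorusTT' (Ls j) 1 s 5) (rectN x (Ls j)) 0 (ψ (Ls j))) →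
      (∀ j, star (ψ (Ls j)) ⬝ᵥ ψ (Ls j) = 1) → ω.IsTorusLimitOf ψ Ls →
      ((rQB : ℚ) : ℝ) ≤ ((Finset.univ : Finset (DihedralGroup 4)).card : ℝ)⁻¹ * ∑ g ∈ (Finset.univ : Finset (DihedralGroup 4)),
        (ω.expect (d4ShiftSet g 0 (Literature.Probability.LatticeModels.box 2 7))
          (fermionEmbed (PolySite.d4Emb g 0 (Literature.Probability.LatticeModels.box 2 7)) (-oddMomentObsTT (-11 / 25) 5 0))).re)
    (hPC : ∀ x ∈ Set.Icc (183 / 200 : ℝ) (477 / 500), ∀ s ∈ Set.Icc (-23 / 50 : ℝ) (-11 / 25),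
      ∀ (ω : InfVolFermionState 2) (Ls : ℕ → ℕ) (ψ : ∀ L, Fock (Orb (FermionTorus 2 L))),
      Tendsto Ls atTop atTop →
      (∀ j, IsGroundStateInSector (hubbardTorusTT' (Ls j) 1 s 5) (rectN x (Ls j)) 0 (ψ (Ls j))) →
      (∀ j, star (ψ (Ls j)) ⬝ᵥ ψ (Ls j) = 1) → ω.IsTorusLimitOf ψ Ls →
      ((rPC : ℚ) : ℝ) ≤ ((Finset.univ : Finset (DihedralGroup 4)).card : ℝ)⁻¹ * ∑ g ∈ (Finset.univ : Finset (DihedralGroup 4)),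
        (ω.expect (d4ShiftSet g 0 (Literature.Probability.LatticeModels.box 2 7))
          (fermionEmbed (PolySite.d4Emb g 0 (Literature.Probability.LatticeModels.box 2 7)) (-oddMomentObsTT (-23 / 50) 5 0))).re)
    (hQC : ∀ x ∈ Set.Icc (183 / 200 : ℝ) (477 / 500), ∀ s ∈ Set.Icc (-23 / 50 : ℝ) (-11 / 25),
      ∀ (ω : InfVolFermionState 2) (Ls : ℕ → ℕ) (ψ : ∀ L, Fock (Orb (FermionTorus 2 L))),
      Tendsto Ls atTop atTop →
      (∀ j, IsGroundStateInSector (hubbardTorusTT' (Ls j) 1 s 5) (rectN x (Ls j)) 0 (ψ (Ls j))) →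
      (∀ j, star (ψ (Ls j)) ⬝ᵥ ψ (Ls j) = 1) → ω.IsTorusLimitOf ψ Ls →
      ((rQC : ℚ) : ℝ) ≤ ((Finset.univ : Finset (DihedralGroup 4)).card : ℝ)⁻¹ * ∑ g ∈ (Finset.univ : Finset (DihedralGroup 4)),
        (ω.expect (d4ShiftSet g 0 (Literature.Probability.LatticeModels.box 2 7))
          (fermionEmbed (PolySite.d4Emb g 0 (Literature.Probability.LatticeModels.box 2 7)) (-oddMomentObsTT (-11 / 25) 5 0))).re)
    (pPA : -rPA ≤ c) (pQA : -rQA ≤ c) (pPB : -rPB ≤ c) (pQB : -rQB ≤ c) (pPC : -rPC ≤ c) (pQC : -rQC ≤ c)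
    (hc : c ≤ 4779578 / 10000000) :
    ∀ tp ∈ Set.Icc (-23 / 50 : ℝ) (-11 / 25), ∀ U ∈ Set.Icc (5 : ℝ) (13 / 2), ∀ n ∈ Set.Icc (9 / 10 : ℝ) (477 / 500),
      ObsStiffnessSeqCeilingAt tp U n (4779578 / 10000000) := by
  intro tp htp U hU n hn
  rcases le_total n (183 / 200) with hlow | hhigh
  · exact ndnio2_M21_lowFillingCell183_below_bar (U := U) htp ⟨by linarith [hn.1], hlow⟩
  have hn' : n ∈ Set.Icc (183 / 200 : ℝ) (477 / 500) := ⟨hhigh, hn.2⟩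
  have eL : (-23 / 50 : ℝ) * (2 - (5 : ℝ) / (13 / 2 : ℝ)) = -(184 / 325) := by norm_num
  have cst : ∀ {r : ℚ}, -r ≤ c → -((r : ℚ) : ℝ) ≤ ((c : ℚ) : ℝ) := fun h => by exact_mod_cast h
  refine (ObsStiffnessSeqCeilingAt_on_box_of_apexStation_twoEndObjectives (p := -23 / 50) (q := -11 / 25) (UA := (5 : ℝ))
    (Umax := (13 / 2 : ℝ)) (n := n) (by norm_num) (by norm_num) (by norm_num) (by linarith [hn'.1]) (by linarith [hn'.2])
    (fun s => if s ≤ -11 / 20 then ((rPA : ℚ) : ℝ) else if s ≤ -23 / 50 then ((rPB : ℚ) : ℝ) else ((rPC : ℚ) : ℝ))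
    (fun s => if s ≤ -11 / 20 then ((rQA : ℚ) : ℝ) else if s ≤ -23 / 50 then ((rQB : ℚ) : ℝ) else ((rQC : ℚ) : ℝ))
    c ?_ ?_ ?_ tp htp U hU).mono hc
  · intro s hs ω Ls ψ hLs hψ h1 hω
    rw [eL] at hs
    by_cases hs1 : s ≤ -11 / 20
    · simp only [if_pos hs1]; exact hPA n hn' s ⟨hs.1, hs1⟩ ω Ls ψ hLs hψ h1 hω
    · by_cases hs2 : s ≤ -23 / 50
      · simp only [if_neg hs1, if_pos hs2]; exact hPB n hn' s ⟨(not_le.1 hs1).le, hs2⟩ ω Ls ψ hLs hψ h1 hω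
      · simp only [if_neg hs1, if_neg hs2]; exact hPC n hn' s ⟨(not_le.1 hs2).le, hs.2⟩ ω Ls ψ hLs hψ h1 hω
  · intro s hs ω Ls ψ hLs hψ h1 hω
    rw [eL] at hs
    by_cases hs1 : s ≤ -11 / 20
    · simp only [if_pos hs1]; exact hQA n hn' s ⟨hs.1, hs1⟩ ω Ls ψ hLs hψ h1 hω
    · by_cases hs2 : s ≤ -23 / 50
      · simp only [if_neg hs1, if_pos hs2]; exact hQB n hn' s ⟨(not_le.1 hs1).le, hs2⟩ ω Ls ψ hLs hψ h1 hω
      · simp only [if_neg hs1, if_neg hs2]; exact hQC n hn' s ⟨(not_le.1 hs2).le, hs.2⟩ ω Ls ψ hLs hψ h1 hω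
  · intro σ hσ s _
    refine neg_slotChord_le_of_neg_le (by norm_num) hσ ?_ ?_
    · by_cases hs1 : s ≤ -11 / 20
      · simp only [if_pos hs1]; exact cst pPA
      · by_cases hs2 : s ≤ -23 / 50
        · simp only [if_neg hs1, if_pos hs2]; exact cst pPB
        · simp only [if_neg hs1, if_neg hs2]; exact cst pPC
    · by_cases hs1 : s ≤ -11 / 20
      · simp only [if_pos hs1]; exact cst pQA
      · by_cases hs2 : s ≤ -23 / 50
        · simp only [if_neg hs1, if_pos hs2]; exact cst pQB
        · simp only [if_neg hs1, if_neg hs2]; exact cst pQC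

/-- **`ResidualHighUSlab` FROM FOUR CONSTANT FAMILIES** (station 5, edition E-R: `P`, `Q` × rectangles `[−276/425, −11/20]`, `[−11/20, −176/325]` × R‴), four prices
`−r ≤ c`, `c ≤ 4779578/10⁷` ⇒ the statement of `Theses.CovNdNiO2M21.ResidualHighUSlab` (box-2's `…_on_highSlab_…`, `U₁ = 13/2`, `U_max = 17/2`).
[cite: KomaTasaki1994, §1] [cite: ScalapinoWhiteZhang1993, §II] -/
theorem ndM21_residualHighUSlab_of_constFamilies {rPA rQA rPB rQB c : ℚ}
    (hPA : ∀ x ∈ Set.Icc (183 / 200 : ℝ) (477 / 500), ∀ s ∈ Set.Icc (-(276 / 425) : ℝ) (-11 / 20),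
      ∀ (ω : InfVolFermionState 2) (Ls : ℕ → ℕ) (ψ : ∀ L, Fock (Orb (FermionTorus 2 L))),
      Tendsto Ls atTop atTop →
      (∀ j, IsGroundStateInSector (hubbardTorusTT' (Ls j) 1 s 5) (rectN x (Ls j)) 0 (ψ (Ls j))) →
      (∀ j, star (ψ (Ls j)) ⬝ᵥ ψ (Ls j) = 1) → ω.IsTorusLimitOf ψ Ls →
      ((rPA : ℚ) : ℝ) ≤ ((Finset.univ : Finset (DihedralGroup 4)).card : ℝ)⁻¹ * ∑ g ∈ (Finset.univ : Finset (DihedralGroup 4)),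
        (ω.expect (d4ShiftSet g 0 (Literature.Probability.LatticeModels.box 2 7))
          (fermionEmbed (PolySite.d4Emb g 0 (Literature.Probability.LatticeModels.box 2 7)) (-oddMomentObsTT (-23 / 50) 5 0))).re)
    (hQA : ∀ x ∈ Set.Icc (183 / 200 : ℝ) (477 / 500), ∀ s ∈ Set.Icc (-(276 / 425) : ℝ) (-11 / 20),
      ∀ (ω : InfVolFermionState 2) (Ls : ℕ → ℕ) (ψ : ∀ L, Fock (Orb (FermionTorus 2 L))),
      Tendsto Ls atTop atTop →
      (∀ j, IsGroundStateInSector (hubbardTorusTT' (Ls j) 1 s 5) (rectN x (Ls j)) 0 (ψ (Ls j))) →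
      (∀ j, star (ψ (Ls j)) ⬝ᵥ ψ (Ls j) = 1) → ω.IsTorusLimitOf ψ Ls →
      ((rQA : ℚ) : ℝ) ≤ ((Finset.univ : Finset (DihedralGroup 4)).card : ℝ)⁻¹ * ∑ g ∈ (Finset.univ : Finset (DihedralGroup 4)),
        (ω.expect (d4ShiftSet g 0 (Literature.Probability.LatticeModels.box 2 7))
          (fermionEmbed (PolySite.d4Emb g 0 (Literature.Probability.LatticeModels.box 2 7)) (-oddMomentObsTT (-11 / 25) 5 0))).re)
    (hPB : ∀ x ∈ Set.Icc (183 / 200 : ℝ) (477 / 500), ∀ s ∈ Set.Icc (-11 / 20 : ℝ) (-(176 / 325)),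
      ∀ (ω : InfVolFermionState 2) (Ls : ℕ → ℕ) (ψ : ∀ L, Fock (Orb (FermionTorus 2 L))),
      Tendsto Ls atTop atTop →
      (∀ j, IsGroundStateInSector (hubbardTorusTT' (Ls j) 1 s 5) (rectN x (Ls j)) 0 (ψ (Ls j))) →
      (∀ j, star (ψ (Ls j)) ⬝ᵥ ψ (Ls j) = 1) → ω.IsTorusLimitOf ψ Ls →
      ((rPB : ℚ) : ℝ) ≤ ((Finset.univ : Finset (DihedralGroup 4)).card : ℝ)⁻¹ * ∑ g ∈ (Finset.univ : Finset (DihedralGroup 4)),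
        (ω.expect (d4ShiftSet g 0 (Literature.Probability.LatticeModels.box 2 7))
          (fermionEmbed (PolySite.d4Emb g 0 (Literature.Probability.LatticeModels.box 2 7)) (-oddMomentObsTT (-23 / 50) 5 0))).re)
    (hQB : ∀ x ∈ Set.Icc (183 / 200 : ℝ) (477 / 500), ∀ s ∈ Set.Icc (-11 / 20 : ℝ) (-(176 / 325)),
      ∀ (ω : InfVolFermionState 2) (Ls : ℕ → ℕ) (ψ : ∀ L, Fock (Orb (FermionTorus 2 L))),
      Tendsto Ls atTop atTop →
      (∀ j, IsGroundStateInSector (hubbardTorusTT' (Ls j) 1 s 5) (rectN x (Ls j)) 0 (ψ (Ls j))) →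
      (∀ j, star (ψ (Ls j)) ⬝ᵥ ψ (Ls j) = 1) → ω.IsTorusLimitOf ψ Ls →
      ((rQB : ℚ) : ℝ) ≤ ((Finset.univ : Finset (DihedralGroup 4)).card : ℝ)⁻¹ * ∑ g ∈ (Finset.univ : Finset (DihedralGroup 4)),
        (ω.expect (d4ShiftSet g 0 (Literature.Probability.LatticeModels.box 2 7))
          (fermionEmbed (PolySite.d4Emb g 0 (Literature.Probability.LatticeModels.box 2 7)) (-oddMomentObsTT (-11 / 25) 5 0))).re)
    (pPA : -rPA ≤ c) (pQA : -rQA ≤ c) (pPB : -rPB ≤ c) (pQB : -rQB ≤ c) (hc : c ≤ 4779578 / 10000000) :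
    ∀ tp ∈ Set.Icc (-23 / 50 : ℝ) (-11 / 25), ∀ U ∈ Set.Icc (13 / 2 : ℝ) (17 / 2), ∀ n ∈ Set.Icc (9 / 10 : ℝ) (477 / 500),
      ObsStiffnessSeqCeilingAt tp U n (4779578 / 10000000) := by
  intro tp htp U hU n hn
  rcases le_total n (183 / 200) with hlow | hhigh
  · exact ndnio2_M21_lowFillingCell183_below_bar (U := U) htp ⟨by linarith [hn.1], hlow⟩
  have hn' : n ∈ Set.Icc (183 / 200 : ℝ) (477 / 500) := ⟨hhigh, hn.2⟩
  have eL : (-23 / 50 : ℝ) * (2 - (5 : ℝ) / (17 / 2 : ℝ)) = -(276 / 425) := by norm_num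
  have eR : (-11 / 25 : ℝ) * (2 - (5 : ℝ) / (13 / 2 : ℝ)) = -(176 / 325) := by norm_num
  have cst : ∀ {r : ℚ}, -r ≤ c → -((r : ℚ) : ℝ) ≤ ((c : ℚ) : ℝ) := fun h => by exact_mod_cast h
  refine (ObsStiffnessSeqCeilingAt_on_highSlab_of_apexStation_twoEndObjectives (p := -23 / 50) (q := -11 / 25) (UA := (5 : ℝ))
    (U₁ := (13 / 2 : ℝ)) (Umax := (17 / 2 : ℝ)) (n := n) (by norm_num) (by norm_num) (by norm_num) (by norm_num)
    (by linarith [hn'.1]) (by linarith [hn'.2])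
    (fun s => if s ≤ -11 / 20 then ((rPA : ℚ) : ℝ) else ((rPB : ℚ) : ℝ))
    (fun s => if s ≤ -11 / 20 then ((rQA : ℚ) : ℝ) else ((rQB : ℚ) : ℝ))
    c ?_ ?_ ?_ tp htp U hU).mono hc
  · intro s hs ω Ls ψ hLs hψ h1 hω
    rw [eL, eR] at hs
    by_cases hs1 : s ≤ -11 / 20
    · simp only [if_pos hs1]; exact hPA n hn' s ⟨hs.1, hs1⟩ ω Ls ψ hLs hψ h1 hω
    · simp only [if_neg hs1]; exact hPB n hn' s ⟨(not_le.1 hs1).le, hs.2⟩ ω Ls ψ hLs hψ h1 hω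
  · intro s hs ω Ls ψ hLs hψ h1 hω
    rw [eL, eR] at hs
    by_cases hs1 : s ≤ -11 / 20
    · simp only [if_pos hs1]; exact hQA n hn' s ⟨hs.1, hs1⟩ ω Ls ψ hLs hψ h1 hω
    · simp only [if_neg hs1]; exact hQB n hn' s ⟨(not_le.1 hs1).le, hs.2⟩ ω Ls ψ hLs hψ h1 hω
  · intro σ hσ s _
    refine neg_slotChord_le_of_neg_le (by norm_num) hσ ?_ ?_
    · by_cases hs1 : s ≤ -11 / 20
      · simp only [if_pos hs1]; exact cst pPA
      · simp only [if_neg hs1]; exact cst pPB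
    · by_cases hs1 : s ≤ -11 / 20
      · simp only [if_pos hs1]; exact cst pQA
      · simp only [if_neg hs1]; exact cst pQB

end ConstFamilies

/-! ## §12 Gluing: sub-bundles of one segment ⇒ one constant family on the segment (any number of pieces, by iteration) -/

section Glue

variable {UA σ : ℝ}

/-- **GLUE TWO ADJACENT `s`-PIECES.** Constant families `r₁` on `[a, m] × [x₁, x₂]` and `r₂` on `[m, b] × [x₁, x₂]` (same station `U_A`, same objective slot `σ`) give
the constant family `min r₁ r₂` on `[a, b] × [x₁, x₂]`. So a segment certified as several shorter bundles (midpoint parents) still feeds the `…_of_constFamilies`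
closers with ONE hypothesis per segment; iterate for more pieces. [cite: BoydVandenberghe2004, §5.9] -/
theorem constFamily_glue {a m b x₁ x₂ : ℝ} {r₁ r₂ : ℚ}
    (h₁ : ∀ x ∈ Set.Icc x₁ x₂, ∀ s ∈ Set.Icc a m,
      ∀ (ω : InfVolFermionState 2) (Ls : ℕ → ℕ) (ψ : ∀ L, Fock (Orb (FermionTorus 2 L))),
      Tendsto Ls atTop atTop →
      (∀ j, IsGroundStateInSector (hubbardTorusTT' (Ls j) 1 s UA) (rectN x (Ls j)) 0 (ψ (Ls j))) →
      (∀ j, star (ψ (Ls j)) ⬝ᵥ ψ (Ls j) = 1) → ω.IsTorusLimitOf ψ Ls →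
      ((r₁ : ℚ) : ℝ) ≤ ((Finset.univ : Finset (DihedralGroup 4)).card : ℝ)⁻¹ * ∑ g ∈ (Finset.univ : Finset (DihedralGroup 4)),
        (ω.expect (d4ShiftSet g 0 (Literature.Probability.LatticeModels.box 2 7))
          (fermionEmbed (PolySite.d4Emb g 0 (Literature.Probability.LatticeModels.box 2 7)) (-oddMomentObsTT σ UA 0))).re)
    (h₂ : ∀ x ∈ Set.Icc x₁ x₂, ∀ s ∈ Set.Icc m b,
      ∀ (ω : InfVolFermionState 2) (Ls : ℕ → ℕ) (ψ : ∀ L, Fock (Orb (FermionTorus 2 L))),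
      Tendsto Ls atTop atTop →
      (∀ j, IsGroundStateInSector (hubbardTorusTT' (Ls j) 1 s UA) (rectN x (Ls j)) 0 (ψ (Ls j))) →
      (∀ j, star (ψ (Ls j)) ⬝ᵥ ψ (Ls j) = 1) → ω.IsTorusLimitOf ψ Ls →
      ((r₂ : ℚ) : ℝ) ≤ ((Finset.univ : Finset (DihedralGroup 4)).card : ℝ)⁻¹ * ∑ g ∈ (Finset.univ : Finset (DihedralGroup 4)),
        (ω.expect (d4ShiftSet g 0 (Literature.Probability.LatticeModels.box 2 7))
          (fermionEmbed (PolySite.d4Emb g 0 (Literature.Probability.LatticeModels.box 2 7)) (-oddMomentObsTT σ UA 0))).re) :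
    ∀ x ∈ Set.Icc x₁ x₂, ∀ s ∈ Set.Icc a b,
      ∀ (ω : InfVolFermionState 2) (Ls : ℕ → ℕ) (ψ : ∀ L, Fock (Orb (FermionTorus 2 L))),
      Tendsto Ls atTop atTop →
      (∀ j, IsGroundStateInSector (hubbardTorusTT' (Ls j) 1 s UA) (rectN x (Ls j)) 0 (ψ (Ls j))) →
      (∀ j, star (ψ (Ls j)) ⬝ᵥ ψ (Ls j) = 1) → ω.IsTorusLimitOf ψ Ls →
      ((min r₁ r₂ : ℚ) : ℝ) ≤ ((Finset.univ : Finset (DihedralGroup 4)).card : ℝ)⁻¹ * ∑ g ∈ (Finset.univ : Finset (DihedralGroup 4)),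
        (ω.expect (d4ShiftSet g 0 (Literature.Probability.LatticeModels.box 2 7))
          (fermionEmbed (PolySite.d4Emb g 0 (Literature.Probability.LatticeModels.box 2 7)) (-oddMomentObsTT σ UA 0))).re := by
  intro x hx s hs ω Ls ψ hLs hψ h1 hω
  rcases le_total s m with hsm | hsm
  · have h := h₁ x hx s ⟨hs.1, hsm⟩ ω Ls ψ hLs hψ h1 hω
    exact le_trans (by exact_mod_cast min_le_left r₁ r₂) h
  · have h := h₂ x hx s ⟨hsm, hs.2⟩ ω Ls ψ hLs hψ h1 hω
    exact le_trans (by exact_mod_cast min_le_right r₁ r₂) h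

/-- **SHRINK / WEAKEN a constant family**: a family `r` on `[a, b] × [x₁, x₂]` is a family `r' ≤ r` on any sub-rectangle. [folklore] -/
theorem constFamily_mono {a b x₁ x₂ a' b' x₁' x₂' : ℝ} {r r' : ℚ}
    (h : ∀ x ∈ Set.Icc x₁ x₂, ∀ s ∈ Set.Icc a b,
      ∀ (ω : InfVolFermionState 2) (Ls : ℕ → ℕ) (ψ : ∀ L, Fock (Orb (FermionTorus 2 L))),
      Tendsto Ls atTop atTop →
      (∀ j, IsGroundStateInSector (hubbardTorusTT' (Ls j) 1 s UA) (rectN x (Ls j)) 0 (ψ (Ls j))) →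
      (∀ j, star (ψ (Ls j)) ⬝ᵥ ψ (Ls j) = 1) → ω.IsTorusLimitOf ψ Ls →
      ((r : ℚ) : ℝ) ≤ ((Finset.univ : Finset (DihedralGroup 4)).card : ℝ)⁻¹ * ∑ g ∈ (Finset.univ : Finset (DihedralGroup 4)),
        (ω.expect (d4ShiftSet g 0 (Literature.Probability.LatticeModels.box 2 7))
          (fermionEmbed (PolySite.d4Emb g 0 (Literature.Probability.LatticeModels.box 2 7)) (-oddMomentObsTT σ UA 0))).re)
    (ha : a ≤ a') (hb : b' ≤ b) (hx₁ : x₁ ≤ x₁') (hx₂ : x₂' ≤ x₂) (hr : r' ≤ r) :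
    ∀ x ∈ Set.Icc x₁' x₂', ∀ s ∈ Set.Icc a' b',
      ∀ (ω : InfVolFermionState 2) (Ls : ℕ → ℕ) (ψ : ∀ L, Fock (Orb (FermionTorus 2 L))),
      Tendsto Ls atTop atTop →
      (∀ j, IsGroundStateInSector (hubbardTorusTT' (Ls j) 1 s UA) (rectN x (Ls j)) 0 (ψ (Ls j))) →
      (∀ j, star (ψ (Ls j)) ⬝ᵥ ψ (Ls j) = 1) → ω.IsTorusLimitOf ψ Ls →
      ((r' : ℚ) : ℝ) ≤ ((Finset.univ : Finset (DihedralGroup 4)).card : ℝ)⁻¹ * ∑ g ∈ (Finset.univ : Finset (DihedralGroup 4)),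
        (ω.expect (d4ShiftSet g 0 (Literature.Probability.LatticeModels.box 2 7))
          (fermionEmbed (PolySite.d4Emb g 0 (Literature.Probability.LatticeModels.box 2 7)) (-oddMomentObsTT σ UA 0))).re :=
  fun x hx s hs ω Ls ψ hLs hψ h1 hω =>
    le_trans (by exact_mod_cast hr) (h x ⟨hx₁.trans hx.1, hx.2.trans hx₂⟩ s ⟨ha.trans hs.1, hs.2.trans hb⟩ ω Ls ψ hLs hψ h1 hω)

end Glue

end Summit.Ventures.CertifiedManyBodySolver.Observables

end
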